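import Summits.ResolutionOfSingularities.ResolutionOfSingularities.Theorems.TowerDictionaryHoldsC
import Summits.ResolutionOfSingularities.ResolutionOfSingularities.Theorems.DefectWalksDeepHolds
import HarnessLib

/-!
# PolyPureTowersDeepHolds — the Theses item `MaxContactCut.PolyPureTowersDeep` (stmt-ResolutionOfSingularities-31769) closed BY NAME

Bookkeeping composition (decomp-res census, critic rows 246/246a and 250): `PolyPureTowersDeep ⟸ DefectWalksDeep`
(`TowerDictionaryHolds.polyPureTowersDeep_of_defectWalksDeep`, Theorems/TowerDictionaryHoldsC, through the discharged
dictionary `TowerDictionaryHolds.towerDictionary_holds`, lens-5) and `DefectWalksDeep` holds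
(`DefectWalksDeepHolds.defectWalksDeep_holds`). No new mathematics; one composition.
-/

set_option linter.dupNamespace false

namespace Summit.ResolutionOfSingularities.ResolutionOfSingularities.Theorems.PolyPureTowersDeepHolds

open Summit.ResolutionOfSingularities.ResolutionOfSingularities.Theorems

/-- **Item 31769 `MaxContactCut.PolyPureTowersDeep` holds** (deep poly-pure forced towers terminate): the tower
dictionary transfers the k-structure along forced towers (`towerDictionary_holds`) and the deep defect walks terminate
(`defectWalksDeep_holds`). [new; composition of landed theorems] [cite: CossartJannsenSaito2020, Lemma 13.4]
[cite: Hauser2010, §G] -/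
theorem polyPureTowersDeep_holds :
    Summit.ResolutionOfSingularities.ResolutionOfSingularities.Theses.MaxContactCut.PolyPureTowersDeep :=
  TowerDictionaryHolds.polyPureTowersDeep_of_defectWalksDeep DefectWalksDeepHolds.defectWalksDeep_holds

end Summit.ResolutionOfSingularities.ResolutionOfSingularities.Theorems.PolyPureTowersDeepHolds
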